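import Literature.AlgebraicGeometry.Frobenioids.KummerClass
import Literature.AnabelianGeometry.EtaleTheta.BiKummer
import HarnessLib

/-!
# [EtTh] §4: the [FrdII] Def. 2.1 (ii) Kummer class `κ_f ∈ H¹(H_A, μ_N)` of a rational function in the §4 setting

S. Mochizuki, *The étale theta function and its Frobenioid-theoretic manifestations*, Publ. RIMS **45**
(2009) [MochizukiEtTh2009], §4: Def 4.1 (ii)(iii) PDF p.87 (printed 313: `H_A`, "`f ∈ O^×(A^birat)` fixed by the
natural action of `H_A`", "(b) there exists a `g ∈ O^×(A^birat)` such that `g^N = f`"), Prop 4.3 (iii) p.91 and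
Thm 4.4 (iii) p.94 ("the Kummer class [cf. [Mzk18], Definition 2.1, (ii)] `κ_f ∈ H¹(H_A, μ_N(A))`")
[cite: MochizukiEtTh2009, Thm 4.4 (iii) p.94]; S. Mochizuki, *The geometry of Frobenioids II*, Kyushu J. Math.
**62** (2008), Def 2.1 (ii) p.16 — the tree's `Literature.AlgebraicGeometry.Frobenioids.Kummer.kummerClassOfRoot` /
`kummerClass` (`Frobenioids/KummerClass.lean`, abc-iut-L1).

This file instantiates the L1 Kummer class in the §4 setting `BiKummerSetting` (`BiKummer.lean`, owner
abc-iut-L2-t3), which so far carried the Kummer-class clauses of Prop 4.3 (iii) / Thm 4.4 (iii) as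
"TODO-merge(abc-iut-L1-t4)" in the docstrings of `Prop43_iii` / `Thm44_iii` (`BiKummerRoots.lean`):
* `BiKummerSetting.BiratCoeff A` — `O^×(A^birat)` as an `Aut_C(A)`-group through the setting's field `biratAut`
  (a type synonym of `S.biratUnits A` carrying that `MulDistribMulAction`, the device of `ConjCoeff` in
  `ContH1Discrete.lean`; NO field is added to the frozen `BiKummerSetting`);
* `BiKummerSetting.kummerClassOfRoot` / `kummerClass` / `kummerClassOfSaturated` — `κ_f ∈ H¹(H_A, μ_N)` for an
  `H_A`-fixed `f ∈ O^×(A^birat)` with an `N`-th root, resp. for an `(N, H_⊙, f)`-saturated `A` (Def 4.1 (iii)),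
  as `Kummer.kummerClassOfRoot` at `Γ := Aut_C(A)`, `H := H_A` (`S.HA A hA`), `O := O^×(A^birat)`.
The transport of these classes along the equivalence `Ψ` of Thm 4.4 — the Kummer-class clause of Thm 4.4 (iii),
sub-DAG row T44-L16 — is the companion `BiKummerThm44SubKummerClass.lean`.

## Modelling notes (honest)
1. `H_A`.  Print's `H_A ⊆ Aut_C(A)/O^×(A)` (Def 4.1 (ii)) is rendered in the tree by the corresponding subgroup
   `S.HA A hA ≤ Aut_C(A)` containing `O^×(A)` (`BiKummer.lean`); the class here is the one for THAT group acting on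
   `O^×(A^birat)` through `biratAut` (print's class is its inflation-free version on the quotient).
2. `μ_N`.  The Kummer cocycle `σ ↦ σ(g)·g⁻¹` of a birational `N`-th root `g ∈ O^×(A^birat)` takes values in the
   cyclotomic portion of order `N` of the commutative group `O^×(A^birat)` ([FrdII] Def 2.1 (i) applied to that
   monoid: `Kummer.Mu N (BiratCoeff A)`), the coefficient module used here.  Print's `μ_N(A) ⊆ O^×(A) ⊆ Aut_C(A)`
   ([FrdII] Def 2.1 (i) for `A`; the tree's `S.mu A N`) maps there under `C → C^birat`; over the abstract
   `BiKummerSetting` (no field relates `units A` and `biratUnits A`) that identification is not expressible and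
   is NOT asserted (cf. Rmk 4.4.1 p.95: "these Kummer classes still depend on … the cyclotome `μ_N(−)`").
3. Universes.  Mathlib's `groupCohomology` takes the group and the `ℤ`-coefficients in ONE universe, so — as in
   L1's [FrdII] §2 files — the `H¹`-valued definitions are for settings whose Hom- and monoid-universes are `0`
   (`Category.{0} D`, `FrdIMonoidStub.{0}`); `K`, `D₀`, `D` keep arbitrary universes; `BiratCoeff` is polymorphic.
DEFS-FREEZE (L2, 2026-08-26T05:00Z) reading: def-bearing = a type synonym with its two instances plus three
wrappers of L1's Kummer class (CONSTRUCTIONS over the frozen interface); no new `Prop` fact, no new field.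
HONEST FRAMING: refereed pre-IUT material ([EtTh] 2009, [FrdII] 2008); nothing here bears on [IUTchIII] Cor. 3.12.
-/

noncomputable section

namespace Literature.AnabelianGeometry.EtaleTheta

open CategoryTheory Opposite Literature.AlgebraicGeometry.Frobenioids groupCohomology

namespace BiKummerSetting

universe u₀ v₀ u v w

/-! ### `O^×(A^birat)` as an `Aut_C(A)`-group (universe-polymorphic) -/

section Coefficients

variable {K : Type u₀} [Field K] {X : SemiGraphs.TemperedArithmeticGroup.{u₀} K} {D₀ : Type u₀}
  [Category.{v₀} D₀] {V : FrdIMonoidStub.{w}} {T : RealifiedDivisorMonoids (D₀ := D₀) V} {D : Type u}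
  [Category.{v} D] {VD : FrdICatStub.{u, v, w} D} (S : BiKummerSetting X T D VD)

/-- `O^×(A^birat)` regarded as an `Aut_C(A)`-group through "the natural action of `Aut_C(A)` on `O^×(A^birat)`"
(the setting's field `biratAut`, Def 4.1 p.86; [FrdII] Def 2.1 (i) "acted on by `Aut_C(A)`"): a type synonym of
`S.biratUnits A` carrying that `MulDistribMulAction`. [cite: MochizukiEtTh2009, Def 4.1 p.86] -/
def BiratCoeff (A : S.C) : Type w := S.biratUnits A

namespace BiratCoeff

variable {S} (A : S.C)

/-- `O^×(A^birat)` is a commutative group (the setting's `instBirat`). [cite: MochizukiEtTh2009, Def 4.1 p.86] -/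
instance instCommGroup : CommGroup (S.BiratCoeff A) := inferInstanceAs (CommGroup (S.biratUnits A))

/-- `Aut_C(A)` acts on `O^×(A^birat)` by group automorphisms, through `biratAut : Aut_C(A) → Aut(O^×(A^birat))`.
[cite: MochizukiEtTh2009, Def 4.1 p.86] -/
instance instMulDistribMulAction : MulDistribMulAction (Aut A) (S.BiratCoeff A) :=
  MulDistribMulAction.compHom (S.biratUnits A) (S.biratAut A)

/-- The identity `O^×(A^birat) ≅ BiratCoeff A`. [cite: MochizukiEtTh2009, Def 4.1 p.86] -/
def of : S.biratUnits A ≃* S.BiratCoeff A := MulEquiv.refl _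

/-- The action on `BiratCoeff A` is `biratAut`. [cite: MochizukiEtTh2009, Def 4.1 p.86] -/
@[simp] theorem smul_of (σ : Aut A) (f : S.biratUnits A) : σ • of A f = of A (S.biratAut A σ f) := rfl

/-- "`f` is fixed by the natural action of `H_A`" (Def 4.1 (iii)) in the language of the `Aut_C(A)`-group
`BiratCoeff A`. [cite: MochizukiEtTh2009, Def 4.1 p.87] -/
theorem smul_of_eq_of_isFixedByHA {A : S.C} {hA : S.IsGalois A} {f : S.biratUnits A}
    (hf : S.IsFixedByHA A hA f) (σ : S.HA A hA) : (σ : Aut A) • of A f = of A f :=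
  hf σ σ.2

end BiratCoeff

end Coefficients

/-! ### Kummer classes in the §4 setting (Hom- and monoid-universe `0`) -/

section KummerClass

variable {K : Type u₀} [Field K] {X : SemiGraphs.TemperedArithmeticGroup.{u₀} K} {D₀ : Type u₀}
  [Category.{v₀} D₀] {V : FrdIMonoidStub.{0}} {T : RealifiedDivisorMonoids (D₀ := D₀) V} {D : Type u}
  [Category.{0} D] {VD : FrdICatStub.{u, 0, 0} D} (S : BiKummerSetting X T D VD)

/-- In the GROUP `O^×(A^birat)` two `N`-th roots of the same element differ by a unit (the torsor hypothesis
of [FrdII] Def 2.1 (ii), automatic here). [cite: MochizukiFrdII2008, Def 2.1 (ii) p.16] -/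
theorem BiratCoeff.nthRootsDifferByUnits (A : S.C) (N : ℕ) : Kummer.NthRootsDifferByUnits N (S.BiratCoeff A) :=
  ⟨fun g g' _ => ⟨toUnits (g' * g⁻¹), (inv_mul_cancel_right g' g).symm⟩⟩

/-- **The Kummer class `κ_f ∈ H¹(H_A, μ_N)`** of an `H_A`-fixed `f ∈ O^×(A^birat)` computed from an `N`-th root
`g` ("`g ∈ O^×(A^birat)` such that `g^N = f`", Def 4.1 (iii)(b)): the [FrdII] Def 2.1 (ii) class
(`Frobenioids.Kummer.kummerClassOfRoot`) for `Γ := Aut_C(A)` acting on `O^×(A^birat)`, `H := H_A`.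
[cite: MochizukiEtTh2009, Thm 4.4 (iii) p.94] -/
def kummerClassOfRoot {A : S.C} (hA : S.IsGalois A) (N : ℕ) {f g : S.biratUnits A} (hg : g ^ N = f)
    (hf : S.IsFixedByHA A hA f) :
    H1 (Rep.ofMulDistribMulAction (S.HA A hA) (Kummer.Mu N (S.BiratCoeff A))) :=
  Kummer.kummerClassOfRoot (Γ := Aut A) (BiratCoeff.nthRootsDifferByUnits S A N) (S.HA A hA)
    (f := BiratCoeff.of A f) (g := BiratCoeff.of A g) hg (BiratCoeff.smul_of_eq_of_isFixedByHA hf)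

/-- **The Kummer class `κ_f`** of an `H_A`-fixed `f ∈ O^×(A^birat)` admitting an `N`-th root (any root gives the
same class, [FrdII] Def 2.1 (ii); `Frobenioids.Kummer.kummerClass`). [cite: MochizukiEtTh2009, Thm 4.4 (iii) p.94] -/
def kummerClass {A : S.C} (hA : S.IsGalois A) (N : ℕ) (f : S.biratUnits A) (hf : S.IsFixedByHA A hA f)
    (hroot : ∃ g : S.biratUnits A, g ^ N = f) :
    H1 (Rep.ofMulDistribMulAction (S.HA A hA) (Kummer.Mu N (S.BiratCoeff A))) :=
  Kummer.kummerClass (Γ := Aut A) (BiratCoeff.nthRootsDifferByUnits S A N) (S.HA A hA)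
    ⟨BiratCoeff.of A f, BiratCoeff.smul_of_eq_of_isFixedByHA hf, hroot⟩

/-- `κ_f` may be computed from any `N`-th root of `f`. [cite: MochizukiFrdII2008, Def 2.1 (ii) p.16] -/
theorem kummerClass_eq_kummerClassOfRoot {A : S.C} (hA : S.IsGalois A) (N : ℕ) {f g : S.biratUnits A}
    (hg : g ^ N = f) (hf : S.IsFixedByHA A hA f) :
    S.kummerClass hA N f hf ⟨g, hg⟩ = S.kummerClassOfRoot hA N hg hf :=
  Kummer.kummerClass_eq _ _ _ hg

/-- **`κ_f` for an `(N, H_⊙, f)`-saturated `A`** (Def 4.1 (iii): `A` is `H_⊙`-ample, hence Galois; `f` is fixed by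
`H_A`; (b) `f` has an `N`-th root in `O^×(A^birat)`) — the class `κ_{f_i}` of Thm 4.4 (iii).
[cite: MochizukiEtTh2009, Thm 4.4 (iii) p.94] -/
def kummerClassOfSaturated {A : S.C} {N : ℕ+} {f : S.biratUnits A} (hs : S.IsSaturated A N f) :
    H1 (Rep.ofMulDistribMulAction (S.HA A hs.isAmple.isGalois) (Kummer.Mu (N : ℕ) (S.BiratCoeff A))) :=
  S.kummerClass hs.isAmple.isGalois N f hs.fixed hs.cond_b

end KummerClass

end BiKummerSetting

end Literature.AnabelianGeometry.EtaleTheta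

end
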